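import Summits.Langlands.Langlands.Theses.SenNullAlignment

/-!
# Sketch — crux idea `real-completions-pay-llc-debt` for `SenNullAlignment.SectorComplement`
(stmt-Langlands-16308; crux-ideate r1 k2, planner-cruxidea-stmt-Langlands-16308-2-0, 2026-08-17)

First-lemma check file (NOT a skeleton).  X = `OddHilbertReciprocity` quantifies `∃ RD : ReciprocityData K`
over EVERY totally real `K`; the completions of totally real fields exhaust the p-adic fields (Krasner +
weak approximation: Harris–Taylor 2001, proof of Lemma II.2.7 and §VII.2), so X already carries a PINNED
local Langlands datum for every `F_w` of every number field `F`, and the junction's child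
`CanonicalReciprocityData` (stmt-Langlands-17930 = `stub_canonicalReciprocityData` of
`Lines/split_SenNullAlignment.lean`) follows from X + two theorem-level lemmas (L1 realisation, L2 transport).
-/

namespace Summit.Langlands.Langlands.Cruxes.SectorComplement.RealCompletionsSNA

open IsDedekindDomain NumberField
open Literature.NumberTheory.Automorphic Literature.NumberTheory.GaloisRepresentations
open Summit.Langlands.Langlands.Theses.SenNullAlignment

/-- Step 0 (PROVED): X delivers pinned reciprocity data for every totally real field, with no
automorphic input (the `∃ RD` sits before `∀ hcpt π`). -/
theorem reciprocityData_nonempty_of_totallyReal (hX : OddHilbertReciprocity)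
    (K : Type) [Field K] [NumberField K] (hK : NumberField.IsTotallyReal K) :
    Nonempty (Summit.Langlands.ReciprocityData K) := by
  obtain ⟨RD, -⟩ := hX K hK
  exact ⟨RD⟩

/-- **L1 — FIRST LEMMA (realisation; theorem-level: Krasner's lemma `IsKrasner.of_completeSpace` +
weak approximation + `K ⊗ ℚ_p ≃ ∏ K_v`).**  Every completion of every number field at a finite place
is, as a topological field, a completion of a TOTALLY REAL number field.
[cite: HarrisTaylorAMS2001, proof of Lemma II.2.7; §VII.2 (pp. 214, 226 of the held text)] -/
def RealCompletionsExhaust : Prop :=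
  ∀ (F : Type) [Field F] [NumberField F] (w : HeightOneSpectrum (𝓞 F)),
    ∃ (K : Type) (_ : Field K) (_ : NumberField K), NumberField.IsTotallyReal K ∧
      ∃ (v : HeightOneSpectrum (𝓞 K)) (e : v.adicCompletion K ≃+* w.adicCompletion F),
        IsHomeomorph e

/-- **L2 — transport (formalisation-level; the pins move because `exists_isLocalArtinMap_holds` and
`IsLocalArtinMap.unique_holds` make `canonicalArtin` THE Artin map on both sides).**  A pinned local
Langlands datum moves along a topological isomorphism of completions, pins included. -/
def PinnedDatumTransport : Prop :=
  ∀ (K : Type) [Field K] [NumberField K] (F : Type) [Field F] [NumberField F]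
    (v : HeightOneSpectrum (𝓞 K)) (w : HeightOneSpectrum (𝓞 F))
    (e : v.adicCompletion K ≃+* w.adicCompletion F), IsHomeomorph e →
    ∀ L : LocalLanglandsDatum (v.adicCompletion K), L.artin.IsCanonical →
      (∀ (E : Type) [Field E] [ValuativeRel E] [TopologicalSpace E] [IsNonarchimedeanLocalField E]
        [Algebra (v.adicCompletion K) E] [FiniteDimensional (v.adicCompletion K) E],
        (L.eps.artin E).IsCanonical) →
      ∃ L' : LocalLanglandsDatum (w.adicCompletion F), L'.artin.IsCanonical ∧
        ∀ (E : Type) [Field E] [ValuativeRel E] [TopologicalSpace E] [IsNonarchimedeanLocalField E]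
          [Algebra (w.adicCompletion F) E] [FiniteDimensional (w.adicCompletion F) E],
          (L'.eps.artin E).IsCanonical

/-- **Composition (PROVED): X + L1 + L2 ⇒ the summit's non-vacuity conjunct for EVERY number field**,
i.e. the junction's child `CanonicalReciprocityData` (stmt-Langlands-17930) — the text of
`stub_canonicalReciprocityData` in `Lines/split_SenNullAlignment.lean`. -/
theorem canonicalReciprocityData_of_oddHilbert (hX : OddHilbertReciprocity)
    (h1 : RealCompletionsExhaust) (h2 : PinnedDatumTransport)
    (F : Type) [Field F] [NumberField F] : Nonempty (Summit.Langlands.ReciprocityData F) := by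
  classical
  have key : ∀ w : HeightOneSpectrum (𝓞 F), ∃ L' : LocalLanglandsDatum (w.adicCompletion F),
      L'.artin.IsCanonical ∧ ∀ (E : Type) [Field E] [ValuativeRel E] [TopologicalSpace E]
        [IsNonarchimedeanLocalField E] [Algebra (w.adicCompletion F) E]
        [FiniteDimensional (w.adicCompletion F) E], (L'.eps.artin E).IsCanonical := by
    intro w
    obtain ⟨K, _, _, hK, v, e, he⟩ := h1 F w
    obtain ⟨RD⟩ := reciprocityData_nonempty_of_totallyReal hX K hK
    exact h2 K F v w e he (RD.llc v) (RD.llc_isCanonical v)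
      (fun E _ _ _ _ _ _ => RD.llc_eps_isCanonical v E)
  choose llc hcan heps using key
  exact ⟨⟨llc, hcan, fun v E _ _ _ _ _ _ => heps v E⟩⟩

/-- The same, stated as the registered stub it discharges given X (signature of
`stub_canonicalReciprocityData`, verbatim): inside the junction `X → Langlands` the child P4 is no longer
a named-fact debt but a theorem modulo L1/L2. -/
theorem stub_canonicalReciprocityData_of (hX : OddHilbertReciprocity)
    (h1 : RealCompletionsExhaust) (h2 : PinnedDatumTransport) :
    ∀ (F : Type) [Field F] [NumberField F], Nonempty (Summit.Langlands.ReciprocityData F) :=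
  fun F _ _ => canonicalReciprocityData_of_oddHilbert hX h1 h2 F

/-- Corollary worth recording: X contains Harris–Taylor's Theorem A (existence of `rec` for some
canonically normalised ε-system) at EVERY p-adic field that is a completion of a number field — the
"local Langlands debt" the sibling disprovers found SMUGGLED by the junction
(`egk_/dor_sectorComplement_localLanglandsDebt`) is, for THIS target, PAID by the target. -/
theorem localLanglandsDatum_nonempty_of_oddHilbert (hX : OddHilbertReciprocity)
    (h1 : RealCompletionsExhaust) (h2 : PinnedDatumTransport)
    (F : Type) [Field F] [NumberField F] (w : HeightOneSpectrum (𝓞 F)) :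
    Nonempty (LocalLanglandsDatum (w.adicCompletion F)) := by
  obtain ⟨RD⟩ := canonicalReciprocityData_of_oddHilbert hX h1 h2 F
  exact ⟨RD.llc w⟩

/-- Sanity instance of L1's binder pattern (the `∃ (K : Type) (_ : Field K) (_ : NumberField K), …`
shape instantiates): over `F = ℚ` every completion is trivially a completion of the totally real
field `ℚ` itself. -/
example (w : HeightOneSpectrum (𝓞 ℚ)) :
    ∃ (K : Type) (_ : Field K) (_ : NumberField K), NumberField.IsTotallyReal K ∧
      ∃ (v : HeightOneSpectrum (𝓞 K)) (e : v.adicCompletion K ≃+* w.adicCompletion ℚ),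
        IsHomeomorph e :=
  ⟨ℚ, inferInstance, inferInstance, inferInstance, w, RingEquiv.refl _, (Homeomorph.refl _).isHomeomorph⟩

/-- L1 at `F = ℚ` (all places at once), PROVED: the trivial case of `RealCompletionsExhaust`. -/
theorem realCompletionsExhaust_rat (w : HeightOneSpectrum (𝓞 ℚ)) :
    ∃ (K : Type) (_ : Field K) (_ : NumberField K), NumberField.IsTotallyReal K ∧
      ∃ (v : HeightOneSpectrum (𝓞 K)) (e : v.adicCompletion K ≃+* w.adicCompletion ℚ),
        IsHomeomorph e :=
  ⟨ℚ, inferInstance, inferInstance, inferInstance, w, RingEquiv.refl _, (Homeomorph.refl _).isHomeomorph⟩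

end Summit.Langlands.Langlands.Cruxes.SectorComplement.RealCompletionsSNA
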